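import Literature.AnabelianGeometry.EtaleTheta.ClassicalTheta
import Mathlib.Analysis.Normed.Group.Ultra
import Mathlib.Algebra.Order.Archimedean.Basic
import Mathlib.Algebra.Ring.GeomSum
import HarnessLib

/-!
# [EtTh] Proposition 1.4 (i) over nonarchimedean fields: the zero locus of `Θ̈` (PROVED)

Mochizuki, *The étale theta function and its Frobenioid-theoretic manifestations*, Publ. RIMS **45**
(2009) 227–349 [cite: MochizukiEtTh2009, Prop 1.4 (i) p.21] (PRIMS PDF p. 21 = printed p. 247). Layer L2 of
the abc-iut cell, wave-2 unit W2-L2-02 (seat abc-iut-L2-t6): DISCHARGE of the named fact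
`ThetaDdotZeroLocus` of `ClassicalTheta.lean` (seat abc-iut-L2-t1) for the series
`Θ̈(Ü) = Σ_{n ∈ ℤ} (-1)^n q̈^{n(n+1)} Ü^{2n+1}` (`thetaDdot q̈ Ü`) over a field `L` complete with respect to a
nontrivial NONARCHIMEDEAN absolute value, `0 < ‖q̈‖ < 1`: `thetaDdotZeroLocus_holds` — for `Ü ≠ 0`,
`Θ̈(Ü) = 0 ↔ Ü = ±q̈^a` (`a ∈ ℤ`), "the zeroes of `Θ̈` on `Ÿ` are precisely the cusps of `Ÿ`" on `L`-valued
points, in every characteristic. The companion file `ClassicalThetaSimpleZeros.lean` treats "multiplicity 1".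

**Method (elementary; no Jacobi triple product).** `Θ̈(1) = 0` in every characteristic (the terms `n` and
`-n-1` cancel: `thetaDdot_one_of_norm_lt_one`), so subtracting `Ü · Θ̈(1)` termwise gives the factorisation
`Θ̈(Ü) = Ü (Ü² - 1) · H(Ü)` with `H(Ü) = Σ_n (-1)^n q̈^{n(n+1)} G_n(Ü²)`, `G_n(V) = (V^n - 1)/(V - 1)` the
two-sided geometric sums (`geomSumZ`, `thetaDdotAux`, `thetaDdot_eq_mul_thetaDdotAux`). On the annulus
`‖q̈‖ < ‖Ü‖ ≤ 1` the term `n = -1` of `H`, namely `Ü^{-2}`, strictly dominates all the others (norm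
`≤ ‖q̈‖² ‖Ü‖^{-4}`), so by the ultrametric inequality `‖H(Ü)‖ = ‖Ü‖^{-2} ≠ 0` (`norm_thetaDdotAux_eq`) and the
zeros of `Θ̈` in the annulus are `Ü = ±1`; the functional equation
`Θ̈(q̈^a Ü) = (-1)^a q̈^{-a²} Ü^{-2a} Θ̈(Ü)` (Prop. 1.4 (ii), `ClassicalTheta.thetaDdot_zpow_mul`) moves every
`Ü ≠ 0` into the annulus.

Prop. 1.4 is classical and undisputed; HONEST FRAMING: this file takes no side on any disputed claim.
-/

namespace Literature.AnabelianGeometry.EtaleTheta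

open Filter Finset
open scoped _root_.Topology

/-! ### Two-sided geometric sums `G_n(V) = (V^n - 1)/(V - 1)`, `n ∈ ℤ` -/

section GeomSum

variable {𝕜 : Type*} [NormedField 𝕜]

/-- The two-sided geometric sum `G_n(V) = (Vⁿ - 1)/(V - 1)` as a Laurent polynomial in `V`:
`1 + V + ⋯ + V^{n-1}` for `n ≥ 0` and `-V^{-m}(1 + V + ⋯ + V^{m-1})` for `n = -m < 0`.
(Elementary; auxiliary for Prop. 1.4 (i).) [cite: MochizukiEtTh2009, Prop 1.4 (i) p.21] -/
def geomSumZ (V : 𝕜) : ℤ → 𝕜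
  | Int.ofNat n => ∑ j ∈ range n, V ^ j
  | Int.negSucc m => -(V⁻¹ ^ (m + 1) * ∑ j ∈ range (m + 1), V ^ j)

/-- `G_n(V) = Σ_{j<n} V^j` for `n ∈ ℕ`.
(Elementary; auxiliary for Prop. 1.4 (i).) [cite: MochizukiEtTh2009, Prop 1.4 (i) p.21] -/
theorem geomSumZ_natCast (V : 𝕜) (n : ℕ) : geomSumZ V n = ∑ j ∈ range n, V ^ j := rfl

/-- `G_{-(m+1)}(V) = -V^{-(m+1)} Σ_{j ≤ m} V^j`.
(Elementary; auxiliary for Prop. 1.4 (i).) [cite: MochizukiEtTh2009, Prop 1.4 (i) p.21] -/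
theorem geomSumZ_negSucc (V : 𝕜) (m : ℕ) :
    geomSumZ V (Int.negSucc m) = -(V⁻¹ ^ (m + 1) * ∑ j ∈ range (m + 1), V ^ j) := rfl

/-- `G_0 = 0`. (aux. Prop. 1.4 (i)) [cite: MochizukiEtTh2009, Prop 1.4 (i) p.21] -/
theorem geomSumZ_zero (V : 𝕜) : geomSumZ V 0 = 0 := by
  show geomSumZ V ((0 : ℕ) : ℤ) = 0
  rw [geomSumZ_natCast, sum_range_zero]

/-- `G_{-1}(V) = -V⁻¹`. (aux. Prop. 1.4 (i)) [cite: MochizukiEtTh2009, Prop 1.4 (i) p.21] -/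
theorem geomSumZ_neg_one (V : 𝕜) : geomSumZ V (-1) = -V⁻¹ := by
  show geomSumZ V (Int.negSucc 0) = _
  rw [geomSumZ_negSucc]
  simp

/-- The defining relation `(V - 1) · G_n(V) = Vⁿ - 1` (`V ≠ 0`, `n ∈ ℤ`).
(Elementary; auxiliary for Prop. 1.4 (i).) [cite: MochizukiEtTh2009, Prop 1.4 (i) p.21] -/
theorem sub_one_mul_geomSumZ {V : 𝕜} (hV : V ≠ 0) (n : ℤ) :
    (V - 1) * geomSumZ V n = V ^ n - 1 := by
  cases n with
  | ofNat n => rw [Int.ofNat_eq_natCast, geomSumZ_natCast, zpow_natCast, mul_comm, geom_sum_mul]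
  | negSucc m =>
    rw [geomSumZ_negSucc, zpow_negSucc, inv_pow]
    have h : (V ^ (m + 1))⁻¹ * V ^ (m + 1) = 1 := inv_mul_cancel₀ (pow_ne_zero _ hV)
    linear_combination (-(V ^ (m + 1))⁻¹) * geom_sum_mul V (m + 1) - h

variable [IsUltrametricDist 𝕜]

/-- Ultrametric estimate: `‖Σ_{j<n} V^j‖ ≤ 1` for `‖V‖ ≤ 1`.
(Elementary; auxiliary for Prop. 1.4 (i).) [cite: MochizukiEtTh2009, Prop 1.4 (i) p.21] -/
theorem norm_geom_sum_le_one {V : 𝕜} (hV : ‖V‖ ≤ 1) (n : ℕ) : ‖∑ j ∈ range n, V ^ j‖ ≤ 1 :=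
  IsUltrametricDist.norm_sum_le_of_forall_le_of_nonneg zero_le_one fun j _ => by
    rw [norm_pow]
    exact pow_le_one₀ (norm_nonneg V) hV

/-- `‖G_{-(m+1)}(V)‖ ≤ ‖V‖^{-(m+1)}` for `‖V‖ ≤ 1`.
(Elementary; auxiliary for Prop. 1.4 (i).) [cite: MochizukiEtTh2009, Prop 1.4 (i) p.21] -/
theorem norm_geomSumZ_negSucc_le {V : 𝕜} (hV : ‖V‖ ≤ 1) (m : ℕ) :
    ‖geomSumZ V (Int.negSucc m)‖ ≤ ‖V‖⁻¹ ^ (m + 1) := by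
  rw [geomSumZ_negSucc, norm_neg, norm_mul, norm_pow, norm_inv]
  exact mul_le_of_le_one_right (pow_nonneg (inv_nonneg.mpr (norm_nonneg V)) _)
    (norm_geom_sum_le_one hV _)

end GeomSum

/-! ### `Θ̈(1) = 0` and the cusps are zeros, in every characteristic -/

section AnyField

variable {𝕜 : Type*} [NormedField 𝕜]

/-- `‖T(q̈, 1, n)‖ = ‖q̈‖^{n(n+1)}`. [cite: MochizukiEtTh2009, Prop 1.4 p.21] -/
theorem norm_thetaDdotTerm_one (q2 : 𝕜) (n : ℤ) :
    ‖thetaDdotTerm q2 1 n‖ = ‖q2‖ ^ (n * (n + 1)) := by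
  rw [norm_thetaDdotTerm, norm_one, one_zpow, mul_one]

/-- Exponent bookkeeping: `n(n+1)` for `n ∈ ℕ` as a natural number.
(Elementary; auxiliary for Prop. 1.4 (i).) [cite: MochizukiEtTh2009, Prop 1.4 (i) p.21] -/
theorem natCast_mul_natCast_add_one (n : ℕ) : (n : ℤ) * (n + 1) = ((n * (n + 1) : ℕ) : ℤ) := by
  push_cast
  ring

/-- Exponent bookkeeping: `n(n+1) = m(m+1)` for `n = -(m+1)`.
(Elementary; auxiliary for Prop. 1.4 (i).) [cite: MochizukiEtTh2009, Prop 1.4 (i) p.21] -/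
theorem negSucc_mul_negSucc_add_one (m : ℕ) :
    Int.negSucc m * (Int.negSucc m + 1) = ((m * (m + 1) : ℕ) : ℤ) := by
  rw [Int.negSucc_eq]
  push_cast
  ring

variable [CompleteSpace 𝕜]

/-- **`Θ̈(1) = 0` in every characteristic** (for `‖q̈‖ < 1`): the terms `n` and `-(n+1)` of the series
at `Ü = 1` cancel. (`ClassicalTheta.thetaDdot_one` proves this via `Θ̈(1) = -Θ̈(1)`, which needs
characteristic `≠ 2`.) [cite: MochizukiEtTh2009, Prop 1.4 (i) p.21] -/
theorem thetaDdot_one_of_norm_lt_one {q2 : 𝕜} (hq : ‖q2‖ < 1) : thetaDdot q2 1 = 0 := by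
  have h1 : Summable fun n : ℕ => thetaDdotTerm q2 1 n :=
    (summable_thetaDdotTerm hq 1).comp_injective Nat.cast_injective
  have h2 : HasSum (fun n : ℕ => thetaDdotTerm q2 1 (-(n + 1)))
      (-(∑' n : ℕ, thetaDdotTerm q2 1 n)) := by
    have h : ∀ n : ℕ, thetaDdotTerm q2 1 (-(n + 1)) = -thetaDdotTerm q2 1 n := fun n => by
      simpa using thetaDdotTerm_inv_neg_succ q2 1 n
    simp only [h]
    exact h1.hasSum.neg
  have h := h1.hasSum.of_nat_of_neg_add_one h2
  rw [add_neg_cancel] at h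
  exact h.tsum_eq

/-- Every cusp `Ü = q̈^a` is a zero, in every characteristic (`‖q̈‖ < 1`, `q̈ ≠ 0`).
[cite: MochizukiEtTh2009, Prop 1.4 (i) p.21] -/
theorem thetaDdot_zpow_of_norm_lt_one {q2 : 𝕜} (hq : ‖q2‖ < 1) (hq0 : q2 ≠ 0) (a : ℤ) :
    thetaDdot q2 (q2 ^ a) = 0 := by
  have h := thetaDdot_zpow_mul hq0 (one_ne_zero (α := 𝕜)) a
  rwa [mul_one, thetaDdot_one_of_norm_lt_one hq, mul_zero] at h

/-- Every cusp `Ü = -q̈^a` is a zero, in every characteristic. [cite: MochizukiEtTh2009, Prop 1.4 (i) p.21] -/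
theorem thetaDdot_neg_zpow_of_norm_lt_one {q2 : 𝕜} (hq : ‖q2‖ < 1) (hq0 : q2 ≠ 0) (a : ℤ) :
    thetaDdot q2 (-(q2 ^ a)) = 0 := by
  rw [thetaDdot_neg, thetaDdot_zpow_of_norm_lt_one hq hq0, neg_zero]

end AnyField

/-! ### The auxiliary series `H(Ü) = Σ_n (-1)^n q̈^{n(n+1)} G_n(Ü²)` with `Θ̈(Ü) = Ü (Ü² - 1) H(Ü)` -/

section Aux

variable {𝕜 : Type*} [NormedField 𝕜]

/-- General term of the auxiliary series: `(-1)^n q̈^{n(n+1)} G_n(Ü²)`. [cite: MochizukiEtTh2009, Prop 1.4 (i) p.21] -/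
def thetaDdotAuxTerm (q2 U : 𝕜) (n : ℤ) : 𝕜 :=
  ((n.negOnePow : ℤ) : 𝕜) * q2 ^ (n * (n + 1)) * geomSumZ (U ^ 2) n

/-- The auxiliary series `H(Ü) = Σ_{n ∈ ℤ} (-1)^n q̈^{n(n+1)} G_n(Ü²)`, so that `Θ̈(Ü) = Ü (Ü² - 1) H(Ü)`
(`thetaDdot_eq_mul_thetaDdotAux`). [cite: MochizukiEtTh2009, Prop 1.4 (i) p.21] -/
noncomputable def thetaDdotAux (q2 U : 𝕜) : 𝕜 :=
  ∑' n : ℤ, thetaDdotAuxTerm q2 U n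

/-- The `n = 0` term vanishes (`G_0 = 0`). [cite: MochizukiEtTh2009, Prop 1.4 (i) p.21] -/
theorem thetaDdotAuxTerm_zero (q2 U : 𝕜) : thetaDdotAuxTerm q2 U 0 = 0 := by
  simp [thetaDdotAuxTerm, geomSumZ_zero]

/-- The `n = -1` term is `Ü^{-2}`. [cite: MochizukiEtTh2009, Prop 1.4 (i) p.21] -/
theorem thetaDdotAuxTerm_neg_one (q2 U : 𝕜) : thetaDdotAuxTerm q2 U (-1) = (U ^ 2)⁻¹ := by
  rw [thetaDdotAuxTerm, geomSumZ_neg_one]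
  simp

/-- Termwise factorisation: `Ü (Ü² - 1) · (-1)^n q̈^{n(n+1)} G_n(Ü²) = T(q̈, Ü, n) - Ü · T(q̈, 1, n)`
(`Ü ≠ 0`). [cite: MochizukiEtTh2009, Prop 1.4 (i) p.21] -/
theorem mul_thetaDdotAuxTerm {q2 U : 𝕜} (hU : U ≠ 0) (n : ℤ) :
    U * (U ^ 2 - 1) * thetaDdotAuxTerm q2 U n = thetaDdotTerm q2 U n - U * thetaDdotTerm q2 1 n := by
  have key : (U ^ 2 - 1) * geomSumZ (U ^ 2) n = (U ^ 2) ^ n - 1 :=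
    sub_one_mul_geomSumZ (pow_ne_zero 2 hU) n
  have e1 : (U ^ 2) ^ n = U ^ (2 * n) := by
    rw [← zpow_natCast, ← zpow_mul]
    norm_num
  have e2 : U ^ (2 * n + 1) = U ^ (2 * n) * U := zpow_add_one₀ hU _
  calc U * (U ^ 2 - 1) * thetaDdotAuxTerm q2 U n
      = ((n.negOnePow : ℤ) : 𝕜) * q2 ^ (n * (n + 1)) * (U * ((U ^ 2 - 1) * geomSumZ (U ^ 2) n)) := by
        rw [thetaDdotAuxTerm]
        ring
    _ = thetaDdotTerm q2 U n - U * thetaDdotTerm q2 1 n := by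
        rw [key, e1, thetaDdotTerm, thetaDdotTerm, e2, one_zpow]
        ring

/-- `‖(-1)^n‖ = 1` in a normed field. [folklore] -/
private theorem norm_cast_negOnePow (n : ℤ) : ‖((n.negOnePow : ℤ) : 𝕜)‖ = 1 := by
  rw [Int.cast_negOnePow, norm_zpow, norm_neg, norm_one, one_zpow]

/-- Summability of the NORMS of the theta series (`‖q̈‖ < 1`): the norms form the same series over `ℝ`
with `q̈ ↦ ‖q̈‖`, `Ü ↦ ‖Ü‖`, up to sign. [cite: MochizukiEtTh2009, Prop 1.4 p.21] -/
theorem summable_norm_thetaDdotTerm {q2 : 𝕜} (hq : ‖q2‖ < 1) (U : 𝕜) :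
    Summable fun n => ‖thetaDdotTerm q2 U n‖ := by
  have hq' : ‖(‖q2‖ : ℝ)‖ < 1 := by rwa [norm_norm]
  refine (summable_thetaDdotTerm hq' ‖U‖).abs.congr fun n => ?_
  rw [← Real.norm_eq_abs, norm_thetaDdotTerm, norm_thetaDdotTerm, norm_norm, norm_norm]

variable [IsUltrametricDist 𝕜]

/-- Bound for `n ≥ 0`, `‖Ü‖ ≤ 1`: `‖(-1)^n q̈^{n(n+1)} G_n(Ü²)‖ ≤ ‖q̈‖^{n(n+1)}`.
[cite: MochizukiEtTh2009, Prop 1.4 (i) p.21] -/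
theorem norm_thetaDdotAuxTerm_natCast_le {q2 U : 𝕜} (hU1 : ‖U‖ ≤ 1) (n : ℕ) :
    ‖thetaDdotAuxTerm q2 U n‖ ≤ ‖q2‖ ^ (n * (n + 1)) := by
  have hV : ‖U ^ 2‖ ≤ 1 := by rw [norm_pow]; exact pow_le_one₀ (norm_nonneg U) hU1
  rw [thetaDdotAuxTerm, norm_mul, norm_mul, norm_cast_negOnePow, one_mul, norm_zpow,
    natCast_mul_natCast_add_one, zpow_natCast]
  exact mul_le_of_le_one_right (pow_nonneg (norm_nonneg _) _) (norm_geom_sum_le_one hV n)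

/-- Bound for `n = -(m+1) < 0`, `‖Ü‖ ≤ 1`: `‖(-1)^n q̈^{n(n+1)} G_n(Ü²)‖ ≤ ‖q̈‖^{m(m+1)} ‖Ü‖^{-2(m+1)}`.
[cite: MochizukiEtTh2009, Prop 1.4 (i) p.21] -/
theorem norm_thetaDdotAuxTerm_negSucc_le {q2 U : 𝕜} (hU1 : ‖U‖ ≤ 1) (m : ℕ) :
    ‖thetaDdotAuxTerm q2 U (Int.negSucc m)‖ ≤ ‖q2‖ ^ (m * (m + 1)) * (‖U‖ ^ 2)⁻¹ ^ (m + 1) := by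
  have hV : ‖U ^ 2‖ ≤ 1 := by rw [norm_pow]; exact pow_le_one₀ (norm_nonneg U) hU1
  have hG := norm_geomSumZ_negSucc_le hV m
  rw [norm_pow] at hG
  rw [thetaDdotAuxTerm, norm_mul, norm_mul, norm_cast_negOnePow, one_mul, norm_zpow,
    negSucc_mul_negSucc_add_one, zpow_natCast]
  exact mul_le_mul_of_nonneg_left hG (pow_nonneg (norm_nonneg _) _)

/-- **Domination**: on the annulus `‖q̈‖ < ‖Ü‖ ≤ 1` every term `n ≠ -1` of `H(Ü)` has norm
`≤ ‖q̈‖² ‖Ü‖^{-4} < ‖Ü‖^{-2} = ‖`term `-1‖`. [cite: MochizukiEtTh2009, Prop 1.4 (i) p.21] -/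
theorem norm_thetaDdotAuxTerm_le_of_ne_neg_one {q2 U : 𝕜} (hqU : ‖q2‖ < ‖U‖) (hU1 : ‖U‖ ≤ 1)
    {n : ℤ} (hn : n ≠ -1) :
    ‖thetaDdotAuxTerm q2 U n‖ ≤ ‖q2‖ ^ 2 * ((‖U‖ ^ 2)⁻¹) ^ 2 := by
  have hq0 : 0 ≤ ‖q2‖ := norm_nonneg q2
  have hq1 : ‖q2‖ ≤ 1 := (hqU.trans_le hU1).le
  have hUpos : 0 < ‖U‖ := hq0.trans_lt hqU
  have hs : 0 < ‖U‖ ^ 2 := by positivity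
  have hs1 : ‖U‖ ^ 2 ≤ 1 := pow_le_one₀ hUpos.le hU1
  have hsinv : 1 ≤ (‖U‖ ^ 2)⁻¹ := one_le_inv_iff₀.mpr ⟨hs, hs1⟩
  have hq2s : ‖q2‖ ^ 2 < ‖U‖ ^ 2 := pow_lt_pow_left₀ hqU hq0 two_ne_zero
  have hC : ‖q2‖ ^ 2 ≤ ‖q2‖ ^ 2 * ((‖U‖ ^ 2)⁻¹) ^ 2 :=
    le_mul_of_one_le_right (pow_nonneg hq0 2) (one_le_pow₀ hsinv)
  rcases n with (_ | k) | (_ | j)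
  · -- `n = 0`: the term vanishes
    rw [Int.ofNat_eq_natCast, Nat.cast_zero, thetaDdotAuxTerm_zero, norm_zero]
    positivity
  · -- `n = k + 1 ≥ 1`: `‖q̈‖^{(k+1)(k+2)} ≤ ‖q̈‖²`
    rw [Int.ofNat_eq_natCast]
    refine (norm_thetaDdotAuxTerm_natCast_le hU1 (k + 1)).trans ((pow_le_pow_of_le_one hq0 hq1 ?_).trans hC)
    nlinarith
  · -- `n = -1` is excluded
    exact absurd rfl hn
  · -- `n = -(j+2) ≤ -2`: `‖q̈‖^{(j+1)(j+2)} s^{-(j+2)} ≤ ‖q̈‖² s^{-2}` since `‖q̈‖^{j+3} ≤ ‖q̈‖² < s`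
    refine (norm_thetaDdotAuxTerm_negSucc_le hU1 (j + 1)).trans ?_
    have hx : ‖q2‖ ^ (j + 3) * (‖U‖ ^ 2)⁻¹ ≤ 1 := by
      rw [mul_inv_le_iff₀ hs, one_mul]
      exact ((pow_le_pow_of_le_one hq0 hq1 (by omega : 2 ≤ j + 3)).trans hq2s.le)
    have hxj : (‖q2‖ ^ (j + 3) * (‖U‖ ^ 2)⁻¹) ^ j ≤ 1 := pow_le_one₀ (by positivity) hx
    calc ‖q2‖ ^ ((j + 1) * (j + 1 + 1)) * (‖U‖ ^ 2)⁻¹ ^ (j + 1 + 1)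
        = ‖q2‖ ^ 2 * ((‖U‖ ^ 2)⁻¹) ^ 2 * (‖q2‖ ^ (j + 3) * (‖U‖ ^ 2)⁻¹) ^ j := by ring
      _ ≤ ‖q2‖ ^ 2 * ((‖U‖ ^ 2)⁻¹) ^ 2 * 1 := by gcongr
      _ = ‖q2‖ ^ 2 * ((‖U‖ ^ 2)⁻¹) ^ 2 := mul_one _

variable [CompleteSpace 𝕜]

/-- Summability of the auxiliary series for `‖q̈‖ < 1`, `0 < ‖Ü‖ ≤ 1` (comparison with the theta series
at `1` and at `Ü^{-2}`). [cite: MochizukiEtTh2009, Prop 1.4 (i) p.21] -/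
theorem summable_thetaDdotAuxTerm {q2 U : 𝕜} (hq : ‖q2‖ < 1) (hU : U ≠ 0) (hU1 : ‖U‖ ≤ 1) :
    Summable (thetaDdotAuxTerm q2 U) := by
  have hUpos : 0 < ‖U‖ := norm_pos_iff.mpr hU
  have hs : 0 < ‖U‖ ^ 2 := by positivity
  have hsinv : 1 ≤ (‖U‖ ^ 2)⁻¹ := one_le_inv_iff₀.mpr ⟨hs, pow_le_one₀ hUpos.le hU1⟩
  refine Summable.of_nat_of_neg_add_one ?_ ?_
  · refine Summable.of_norm_bounded
      ((summable_norm_thetaDdotTerm hq 1).comp_injective Nat.cast_injective) fun n => ?_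
    rw [Function.comp_apply, norm_thetaDdotTerm_one, natCast_mul_natCast_add_one, zpow_natCast]
    exact norm_thetaDdotAuxTerm_natCast_le hU1 n
  · refine Summable.of_norm_bounded
      ((summable_norm_thetaDdotTerm hq (U ^ 2)⁻¹).comp_injective Nat.cast_injective) fun m => ?_
    rw [Function.comp_apply, ← Int.negSucc_eq, norm_thetaDdotTerm, natCast_mul_natCast_add_one,
      zpow_natCast, norm_inv, norm_pow,
      show (2 : ℤ) * (m : ℕ) + 1 = ((2 * m + 1 : ℕ) : ℤ) by push_cast; ring, zpow_natCast]
    refine (norm_thetaDdotAuxTerm_negSucc_le hU1 m).trans ?_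
    exact mul_le_mul_of_nonneg_left (pow_le_pow_right₀ hsinv (by omega))
      (pow_nonneg (norm_nonneg _) _)

/-- **The factorisation `Θ̈(Ü) = Ü (Ü² - 1) · H(Ü)`** (`‖q̈‖ < 1`, `Ü ≠ 0`), from
`Θ̈(Ü) - Ü Θ̈(1) = Σ_n (T(q̈, Ü, n) - Ü T(q̈, 1, n))` and `Θ̈(1) = 0`. [cite: MochizukiEtTh2009, Prop 1.4 (i) p.21] -/
theorem thetaDdot_eq_mul_thetaDdotAux {q2 U : 𝕜} (hq : ‖q2‖ < 1) (hU : U ≠ 0) :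
    thetaDdot q2 U = U * (U ^ 2 - 1) * thetaDdotAux q2 U := by
  have h : thetaDdot q2 U - U * thetaDdot q2 1 = U * (U ^ 2 - 1) * thetaDdotAux q2 U := by
    rw [thetaDdot, thetaDdot, thetaDdotAux, ← tsum_mul_left, ← tsum_mul_left,
      ← (summable_thetaDdotTerm hq U).tsum_sub ((summable_thetaDdotTerm hq 1).mul_left U)]
    exact tsum_congr fun n => (mul_thetaDdotAuxTerm hU n).symm
  rwa [thetaDdot_one_of_norm_lt_one hq, mul_zero, sub_zero] at h

/-- **Nonvanishing of `H` on the annulus**: for `‖q̈‖ < ‖Ü‖ ≤ 1` (and `‖q̈‖ < 1`),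
`‖H(Ü)‖ = ‖Ü‖^{-2}` — the term `n = -1` dominates (ultrametric inequality).
[cite: MochizukiEtTh2009, Prop 1.4 (i) p.21] -/
theorem norm_thetaDdotAux_eq {q2 U : 𝕜} (hq : ‖q2‖ < 1) (hqU : ‖q2‖ < ‖U‖) (hU1 : ‖U‖ ≤ 1) :
    ‖thetaDdotAux q2 U‖ = (‖U‖ ^ 2)⁻¹ := by
  classical
  have hUpos : 0 < ‖U‖ := (norm_nonneg q2).trans_lt hqU
  have hU : U ≠ 0 := norm_pos_iff.mp hUpos
  have hs : 0 < ‖U‖ ^ 2 := by positivity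
  have hsum := summable_thetaDdotAuxTerm hq hU hU1
  have hC0 : 0 ≤ ‖q2‖ ^ 2 * ((‖U‖ ^ 2)⁻¹) ^ 2 := by positivity
  have hClt : ‖q2‖ ^ 2 * ((‖U‖ ^ 2)⁻¹) ^ 2 < (‖U‖ ^ 2)⁻¹ := by
    have hq2s : ‖q2‖ ^ 2 < ‖U‖ ^ 2 := pow_lt_pow_left₀ hqU (norm_nonneg q2) two_ne_zero
    have h1 : ‖q2‖ ^ 2 * (‖U‖ ^ 2)⁻¹ < 1 := by rwa [mul_inv_lt_iff₀ hs, one_mul]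
    calc ‖q2‖ ^ 2 * ((‖U‖ ^ 2)⁻¹) ^ 2 = ‖q2‖ ^ 2 * (‖U‖ ^ 2)⁻¹ * (‖U‖ ^ 2)⁻¹ := by ring
      _ < 1 * (‖U‖ ^ 2)⁻¹ := mul_lt_mul_of_pos_right h1 (inv_pos.mpr hs)
      _ = (‖U‖ ^ 2)⁻¹ := one_mul _
  have hmain : ‖thetaDdotAuxTerm q2 U (-1)‖ = (‖U‖ ^ 2)⁻¹ := by
    rw [thetaDdotAuxTerm_neg_one, norm_inv, norm_pow]
  have hrest : ‖∑' n : ℤ, ite (n = -1) 0 (thetaDdotAuxTerm q2 U n)‖ ≤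
      ‖q2‖ ^ 2 * ((‖U‖ ^ 2)⁻¹) ^ 2 := by
    refine IsUltrametricDist.norm_tsum_le_of_forall_le_of_nonneg hC0 fun n => ?_
    split_ifs with hn
    · rw [norm_zero]
      exact hC0
    · exact norm_thetaDdotAuxTerm_le_of_ne_neg_one hqU hU1 hn
  rw [thetaDdotAux, hsum.tsum_eq_add_tsum_ite (-1),
    IsUltrametricDist.norm_add_eq_max_of_norm_ne_norm (by rw [hmain]; exact (hrest.trans_lt hClt).ne'),
    hmain, max_eq_left (hrest.trans hClt.le)]

/-- **Zeros in the fundamental annulus**: for `‖q̈‖ < ‖Ü‖ ≤ 1`, `Θ̈(Ü) = 0 ↔ Ü = ±1`.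
[cite: MochizukiEtTh2009, Prop 1.4 (i) p.21] -/
theorem thetaDdot_eq_zero_iff_of_mem_annulus {q2 U : 𝕜} (hq : ‖q2‖ < 1) (hqU : ‖q2‖ < ‖U‖)
    (hU1 : ‖U‖ ≤ 1) : thetaDdot q2 U = 0 ↔ U = 1 ∨ U = -1 := by
  have hU : U ≠ 0 := norm_pos_iff.mp ((norm_nonneg q2).trans_lt hqU)
  have hH : thetaDdotAux q2 U ≠ 0 := by
    rw [← norm_pos_iff, norm_thetaDdotAux_eq hq hqU hU1]
    have : 0 < ‖U‖ := norm_pos_iff.mpr hU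
    positivity
  rw [thetaDdot_eq_mul_thetaDdotAux hq hU, mul_eq_zero, mul_eq_zero, or_iff_left hH,
    or_iff_right hU, sub_eq_zero, sq, mul_self_eq_one_iff]

end Aux

/-! ### The zero locus (Proposition 1.4 (i)): `ThetaDdotZeroLocus` PROVED -/

section ZeroLocus

variable {L : Type*} [NontriviallyNormedField L]

/-- Every `Ü ≠ 0` is moved into the fundamental annulus `‖q̈‖ < ‖q̈^a Ü‖ ≤ 1` by a power of `q̈`
(`0 < ‖q̈‖ < 1`).
(Elementary; auxiliary for Prop. 1.4 (i).) [cite: MochizukiEtTh2009, Prop 1.4 (i) p.21] -/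
theorem exists_norm_zpow_mul_mem_Ioc {q2 U : L} (hq0 : 0 < ‖q2‖) (hq : ‖q2‖ < 1) (hU : U ≠ 0) :
    ∃ a : ℤ, ‖q2‖ < ‖q2 ^ a * U‖ ∧ ‖q2 ^ a * U‖ ≤ 1 := by
  obtain ⟨n, hn1, hn2⟩ := exists_mem_Ioc_zpow (norm_pos_iff.mpr hU) ((one_lt_inv₀ hq0).mpr hq)
  have hpos : 0 < ‖q2‖ ^ (n + 1) := zpow_pos hq0 _
  have hinv : ‖q2‖ ^ (n + 1) * ‖q2‖⁻¹ ^ (n + 1) = 1 := by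
    rw [inv_zpow', ← zpow_add₀ hq0.ne', add_neg_cancel, zpow_zero]
  refine ⟨n + 1, ?_, ?_⟩ <;> rw [norm_mul, norm_zpow]
  · calc ‖q2‖ = ‖q2‖ ^ (n + 1) * ‖q2‖⁻¹ ^ n := by
          rw [inv_zpow', ← zpow_add₀ hq0.ne', show n + 1 + -n = 1 by ring, zpow_one]
      _ < ‖q2‖ ^ (n + 1) * ‖U‖ := mul_lt_mul_of_pos_left hn1 hpos
  · calc ‖q2‖ ^ (n + 1) * ‖U‖ ≤ ‖q2‖ ^ (n + 1) * ‖q2‖⁻¹ ^ (n + 1) :=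
          mul_le_mul_of_nonneg_left hn2 hpos.le
      _ = 1 := hinv

variable [CompleteSpace L] [IsUltrametricDist L]

/-- **Prop. 1.4 (i), zero locus, nonarchimedean (PROVED)**: for `L` complete nontrivially normed
ultrametric, `0 < ‖q̈‖ < 1` and `Ü ≠ 0`: `Θ̈(Ü) = 0 ↔ Ü = ±q̈^a` for some `a ∈ ℤ` — "the zeroes of `Θ̈`
on `Ÿ` are precisely the cusps of `Ÿ`" on `L`-valued points. Valid in every characteristic.
[cite: MochizukiEtTh2009, Prop 1.4 (i) p.21] -/
theorem thetaDdot_eq_zero_iff {q2 : L} (hq0 : 0 < ‖q2‖) (hq : ‖q2‖ < 1) {U : L} (hU : U ≠ 0) :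
    thetaDdot q2 U = 0 ↔ ∃ a : ℤ, U = q2 ^ a ∨ U = -(q2 ^ a) := by
  have hq0' : q2 ≠ 0 := norm_pos_iff.mp hq0
  constructor
  · intro h
    obtain ⟨a, ha1, ha2⟩ := exists_norm_zpow_mul_mem_Ioc hq0 hq hU
    have hqa : q2 ^ a ≠ 0 := zpow_ne_zero a hq0'
    have hW : thetaDdot q2 (q2 ^ a * U) = 0 := by rw [thetaDdot_zpow_mul hq0' hU, h, mul_zero]
    rcases (thetaDdot_eq_zero_iff_of_mem_annulus hq ha1 ha2).mp hW with h1 | h1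
    · exact ⟨-a, Or.inl (by rw [zpow_neg]; exact eq_inv_of_mul_eq_one_right h1)⟩
    · refine ⟨-a, Or.inr ?_⟩
      have h2 : q2 ^ a * -U = 1 := by rw [mul_neg, h1, neg_neg]
      rw [zpow_neg, ← eq_inv_of_mul_eq_one_right h2, neg_neg]
  · rintro ⟨a, h | h⟩ <;> rw [h]
    exacts [thetaDdot_zpow_of_norm_lt_one hq hq0' a, thetaDdot_neg_zpow_of_norm_lt_one hq hq0' a]

end ZeroLocus

/-- **DISCHARGE of the named fact `ThetaDdotZeroLocus`** (`ClassicalTheta.lean`, Prop. 1.4 (i), zero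
locus over complete nonarchimedean fields): PROVED, by the ultrametric dominant-term argument of this
file. [cite: MochizukiEtTh2009, Prop 1.4 (i) p.21] -/
theorem thetaDdotZeroLocus_holds : ThetaDdotZeroLocus :=
  fun _L _ _ _ _q2 hq0 hq _U hU => thetaDdot_eq_zero_iff hq0 hq hU

end Literature.AnabelianGeometry.EtaleTheta
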